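import Literature.NumberTheory.Automorphic.Liu2021.AppendixC.Thm418LabelSeparation
import Literature.NumberTheory.Automorphic.Liu2021.AppendixC.RestOneLevelInvariants
import Literature.NumberTheory.GaloisRepresentations.FrobeniusDensityOneProofs
import Literature.NumberTheory.DiophantineGeometry.AVGaloisModuleContinuityProofs
import Literature.AlgebraicGeometry.Motives.AbelianVarietyGoodReductionFrobenius
import Mathlib.Topology.Algebra.Module.FiniteDimension
import Mathlib.RingTheory.TensorProduct.Free
import HarnessLib

/-!
# [Liu 2021, Thm 4.15] pinned ⇐ its FROBENIUS FORM: «Frobenius-dense ⇒ all σ» (row III-9′, first rung R0 / stub (S6))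

Topic `NumberTheory/Automorphic/Liu2021/AppendixC`; namespace `Literature.NumberTheory.Automorphic.Liu2021.AppendixC`.
THEOREMS ONLY (no definition, no named fact, no `sorry`).  Cell `hodgecm-mathlib`, (T2) first rung: the binder
`Thm415Pinned C U ℓ X ι μ hμ Aμ iμ` (B-typ04, `Thm415Pinned.lean` :216 — «`Γ_E` acts on `Hom_{ℚ_ℓ^{ac}[𝔾]}(ι∘ω(μ,ε,χ), ℚ_ℓ^{ac}⊗H¹_ét(A_∞))`
by the scalar it has on the `M_μ`-eigenline of `ℚ_ℓ^{ac}⊗H¹_ét(A_μ)`», for ALL `σ ∈ Γ_E`) follows from its FROBENIUS FORM — print's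
«`ρ_{τ',ℓ}(μ,ε,χ) ∘ τ' = μ^{alg}`» ([Liu2021] Thm 4.15, l. 2180) READ AT ARITHMETIC FROBENII: for almost all finite places `v` of `E`,
every arithmetic Frobenius at a prime above `v` acts on that Hom-space by `ι(μ^{alg}(ϖ_v))⁻¹` — together with [Liu2021, Def. 4.5 (2)]
in Frobenius form for `(A_μ, i_μ)` (`Def45.IsCMCharacterMuAlg`, whose eigenline consequence is the tree's
`galoisH1Bar_eq_smul_of_isCMCharacterMuAlg`).

Proof («Frobenius-dense ⇒ all σ»).  Fix `x ≠ 0` on the eigenline and `y = f w`.  The set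
`Z = {σ | ∃ a, σ·x = a·x ∧ σ·y = a·y}` is (i) closed — `y` comes from one level `H¹_ét(A_K)` of the tower, both Galois actions are
base changes of the CONTINUOUS rational Tate representations (`continuous_rationalTateRep_holds`), and `Z` is the preimage of the
kernel of a `ℚ_ℓ`-linear map under the continuous matrix-coefficient map `Γ_E → ℚ_ℓ^N` (`Submodule.closed_of_finiteDimensional`);
(ii) stable under products; (iii) contains every arithmetic Frobenius over a cofinite set of places (the two Frobenius forms).
The tree's UNCONDITIONAL density criterion `absoluteGaloisGroup.eq_univ_of_frobenius_mem_of_hasDirichletDensity_one`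
(Frobenius' density theorem, `FrobeniusDensityOneProofs.lean`) gives `Z = Γ_E`; comparing scalars on `x ≠ 0` ends the proof.

References: [Liu2021] Thm 4.15 (FJcycle.tex l. 2177–2182), §4.3 (l. 2162–2174), Def. 4.5 (2) (l. 1952), Thm 4.18 proof
(l. 2258–2268); [SerreTate1968] §1 (continuity of `ρ_ℓ`), §7 Thm. 10–11; [NeukirchANT1999] VII §13 (density of Frobenii).
-/

set_option autoImplicit false

noncomputable section

open NumberField IsDedekindDomain
open scoped TensorProduct NumberField

namespace Literature.NumberTheory.Automorphic.Liu2021.AppendixC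

open Literature.AlgebraicGeometry.Motives (AbelianVariety)
open Literature.NumberTheory.GaloisRepresentations
open Literature.NumberTheory.LFunctions Literature.NumberTheory.LFunctions.NumberField
open Literature.AlgebraicGeometry.Liu2021 (IsAdmissibleElement)

/-! ## §1. Matrix coefficients of the contragredient Galois action and closedness of the common-eigenvector locus -/
section Closed

variable {E : Type} [Field E] [NumberField E] (ℓ : ℕ) [Fact ℓ.Prime]

/-- `ℓ ≠ 0` in a number field. [folklore] -/
private theorem prime_natCast_ne_zero_numberField : (ℓ : E) ≠ 0 :=
  Nat.cast_ne_zero.mpr (Fact.out : ℓ.Prime).ne_zero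

/-- **Matrix coefficients of `ρ_B(σ⁻¹)` are continuous on `Γ_E`**: for a linear form `φ` on `V_ℓ(B)` and a vector `u`,
`σ ↦ φ(ρ_B(σ⁻¹) u)` is continuous (joint continuity of `Γ_E × V_ℓ B → V_ℓ B`, `continuous_rationalTateRep_holds`; every linear
form on the module topology is continuous). [cite: SerreTate1968, §1] -/
theorem continuous_dual_coeff (B : AbelianVariety E) (φ : Module.Dual ℚ_[ℓ] (B.rationalTateModule ℓ))
    (u : B.rationalTateModule ℓ) :
    Continuous fun σ : Field.absoluteGaloisGroup E => φ (B.rationalTateRep ℓ σ⁻¹ u) := by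
  have hℓ : (ℓ : E) ≠ 0 := prime_natCast_ne_zero_numberField (E := E) ℓ
  have hc : Continuous fun p : Field.absoluteGaloisGroup E × B.rationalTateModule ℓ => B.rationalTateRep ℓ p.1 p.2 :=
    Literature.AlgebraicGeometry.Motives.AbelianVariety.continuous_rationalTateRep_holds B ℓ hℓ
  have hφ : Continuous φ := IsModuleTopology.continuous_of_linearMap φ
  have h2 : Continuous fun σ : Field.absoluteGaloisGroup E => (σ⁻¹, u) :=
    (continuous_inv (G := Field.absoluteGaloisGroup E)).prodMk continuous_const
  -- (compose WITHOUT an expected type: the higher-order unification `?g ∘ ?f =?= fun σ => …` times out otherwise)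
  have h3 := hc.comp h2
  have h4 := hφ.comp h3
  exact h4

variable {ι : Type}

/-- The matrix-coefficient map `σ ↦ (b^*_i (ρ_B(σ⁻¹) b_j))_{(i,j)}` of the contragredient action in a basis `b` of `V_ℓ(B)`.
Continuity. [cite: SerreTate1968, §1] -/
theorem continuous_coeffMap (B : AbelianVariety E) (b : Module.Basis ι ℚ_[ℓ] (B.rationalTateModule ℓ)) :
    Continuous fun σ : Field.absoluteGaloisGroup E => fun k : ι × ι => b.coord k.1 (B.rationalTateRep ℓ σ⁻¹ (b k.2)) :=
  continuous_pi fun k => continuous_dual_coeff ℓ B (b.coord k.1) (b k.2)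

omit [NumberField E] in
/-- The `ℚ_ℓ`-linear «reconstruction» map of a vector `z ∈ ℚ_ℓ^{ac} ⊗ V_ℓ(B)^∨` in a basis `b`: a matrix `m` is sent to
`∑_{(i,j)} m_{ij} · z_i · (1 ⊗ b^*_j)`, `z_i` the coordinates of `z` in the basis `1 ⊗ b^*`. [folklore] -/
private theorem reconstruct_apply [Fintype ι] [DecidableEq ι] (B : AbelianVariety E) (b : Module.Basis ι ℚ_[ℓ] (B.rationalTateModule ℓ))
    (z : AlgebraicClosure ℚ_[ℓ] ⊗[ℚ_[ℓ]] Module.Dual ℚ_[ℓ] (B.rationalTateModule ℓ)) (m : ι × ι → ℚ_[ℓ]) :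
    (∑ k : ι × ι, (LinearMap.proj k : (ι × ι → ℚ_[ℓ]) →ₗ[ℚ_[ℓ]] ℚ_[ℓ]).smulRight
        ((Algebra.TensorProduct.basis (AlgebraicClosure ℚ_[ℓ]) b.dualBasis).repr z k.1 •
          Algebra.TensorProduct.basis (AlgebraicClosure ℚ_[ℓ]) b.dualBasis k.2)) m =
      ∑ k : ι × ι, m k • ((Algebra.TensorProduct.basis (AlgebraicClosure ℚ_[ℓ]) b.dualBasis).repr z k.1 •
          Algebra.TensorProduct.basis (AlgebraicClosure ℚ_[ℓ]) b.dualBasis k.2) := by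
  simp only [LinearMap.coe_sum, Finset.sum_apply, LinearMap.smulRight_apply, LinearMap.proj_apply]

omit [NumberField E] in
/-- **KEY IDENTITY**: the contragredient Galois action `galoisH1Bar ℓ B σ` on `z ∈ ℚ_ℓ^{ac} ⊗ H¹_ét(B)` is the reconstruction map of `z`
applied to the matrix coefficients of `ρ_B(σ⁻¹)` — i.e. `σ·z` depends `ℚ_ℓ`-LINEARLY on the (continuously varying) matrix of `σ⁻¹`.
[cite: Liu2021, Thm 4.18 proof (FJcycle.tex l. 2263)] [cite: SerreTate1968, §1] -/
theorem galoisH1Bar_eq_reconstruct [Fintype ι] [DecidableEq ι] (B : AbelianVariety E) (b : Module.Basis ι ℚ_[ℓ] (B.rationalTateModule ℓ))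
    (z : AlgebraicClosure ℚ_[ℓ] ⊗[ℚ_[ℓ]] Module.Dual ℚ_[ℓ] (B.rationalTateModule ℓ)) (σ : Field.absoluteGaloisGroup E) :
    galoisH1Bar ℓ B σ z =
      ∑ k : ι × ι, (b.coord k.1 (B.rationalTateRep ℓ σ⁻¹ (b k.2))) •
        ((Algebra.TensorProduct.basis (AlgebraicClosure ℚ_[ℓ]) b.dualBasis).repr z k.1 •
          Algebra.TensorProduct.basis (AlgebraicClosure ℚ_[ℓ]) b.dualBasis k.2) := by
  classical
  set bL := Algebra.TensorProduct.basis (AlgebraicClosure ℚ_[ℓ]) b.dualBasis with hbL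
  -- the action on the basis vectors `1 ⊗ b^*_i`
  have hbasis : ∀ i : ι, galoisH1Bar ℓ B σ (bL i) =
      ∑ j : ι, (b.coord i (B.rationalTateRep ℓ σ⁻¹ (b j))) • bL j := by
    intro i
    rw [hbL, Algebra.TensorProduct.basis_apply, galoisH1Bar_tmul]
    have hdual : (B.rationalTateRep ℓ).dual σ (b.dualBasis i) =
        ∑ j : ι, (b.coord i (B.rationalTateRep ℓ σ⁻¹ (b j))) • b.coord j := by
      rw [Representation.dual_apply, Module.Dual.transpose_apply, Module.Basis.coe_dualBasis]
      rw [← Module.Basis.sum_dual_apply_smul_coord b (b.coord i ∘ₗ B.rationalTateRep ℓ σ⁻¹)]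
      rfl
    rw [hdual, TensorProduct.tmul_sum]
    refine Finset.sum_congr rfl fun j _ => ?_
    rw [TensorProduct.tmul_smul, Algebra.TensorProduct.basis_apply, Module.Basis.coe_dualBasis]
  -- expand `z` in the basis and use linearity
  conv_lhs => rw [← bL.sum_repr z]
  rw [map_sum]
  simp_rw [map_smul, hbasis, Finset.smul_sum]
  rw [Fintype.sum_prod_type]
  refine Finset.sum_congr rfl fun i _ => Finset.sum_congr rfl fun j _ => ?_
  rw [smul_comm]


/-- Only finitely many finite places of a number field lie above the prime `ℓ`. [folklore] -/
private theorem finite_setOf_prime_mem_asIdeal :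
    {v : HeightOneSpectrum (𝓞 E) | (ℓ : 𝓞 E) ∈ v.asIdeal}.Finite := by
  have hI : (Ideal.span {(ℓ : 𝓞 E)} : Ideal (𝓞 E)) ≠ ⊥ := by
    rw [Ne, Ideal.span_singleton_eq_bot]
    exact_mod_cast (Fact.out : ℓ.Prime).ne_zero
  exact (Ideal.finite_factors hI).subset fun v hv => Ideal.dvd_span_singleton.2 hv

omit [NumberField E] in
/-- `galoisH1Bar` is multiplicative in `σ` (it is the base change of a representation). [folklore] -/
private theorem galoisH1Bar_mul_apply (B : AbelianVariety E) (σ τ : Field.absoluteGaloisGroup E)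
    (z : AlgebraicClosure ℚ_[ℓ] ⊗[ℚ_[ℓ]] Module.Dual ℚ_[ℓ] (B.rationalTateModule ℓ)) :
    galoisH1Bar ℓ B (σ * τ) z = galoisH1Bar ℓ B σ (galoisH1Bar ℓ B τ z) := by
  unfold galoisH1Bar
  rw [map_mul, Module.End.mul_eq_comp, LinearMap.baseChange_comp, LinearMap.comp_apply]

/-- **CLOSEDNESS OF THE COMMON-EIGENVECTOR LOCUS.**  For abelian varieties `B, B'` over the number field `E`, a non-zero
`x ∈ ℚ_ℓ^{ac} ⊗ H¹_ét(B)`, a vector `y' ∈ ℚ_ℓ^{ac} ⊗ H¹_ét(B')` and ANY `ℚ_ℓ^{ac}`-linear map `T` out of the latter (in the application: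
the canonical map of one level into `ℚ_ℓ^{ac} ⊗ H¹_ét(A_∞)`), the set of `σ ∈ Γ_E` acting on `x` and on `T y'` (through `T`) by a COMMON
scalar is CLOSED in the Krull topology.  Proof: it is the preimage, under the continuous matrix-coefficient map `Γ_E → ℚ_ℓ^N`
(`continuous_coeffMap`, from `continuous_rationalTateRep_holds`), of the kernel of a `ℚ_ℓ`-linear map on the finite-dimensional
`ℚ_ℓ^N` (`galoisH1Bar_eq_reconstruct`; the scalar is read off by a linear form `λ` with `λ x = 1`), and such kernels are closed
(`Submodule.closed_of_finiteDimensional`). [cite: SerreTate1968, §1] [cite: NeukirchANT1999, VII §13] -/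
theorem isClosed_setOf_exists_common_smul (B B' : AbelianVariety E)
    {W : Type*} [AddCommGroup W] [Module (AlgebraicClosure ℚ_[ℓ]) W] [Module ℚ_[ℓ] W]
    [IsScalarTower ℚ_[ℓ] (AlgebraicClosure ℚ_[ℓ]) W]
    (T : (AlgebraicClosure ℚ_[ℓ] ⊗[ℚ_[ℓ]] Module.Dual ℚ_[ℓ] (B'.rationalTateModule ℓ)) →ₗ[AlgebraicClosure ℚ_[ℓ]] W)
    {x : AlgebraicClosure ℚ_[ℓ] ⊗[ℚ_[ℓ]] Module.Dual ℚ_[ℓ] (B.rationalTateModule ℓ)} (hx : x ≠ 0)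
    (y' : AlgebraicClosure ℚ_[ℓ] ⊗[ℚ_[ℓ]] Module.Dual ℚ_[ℓ] (B'.rationalTateModule ℓ)) :
    IsClosed {σ : Field.absoluteGaloisGroup E | ∃ a : AlgebraicClosure ℚ_[ℓ],
      galoisH1Bar ℓ B σ x = a • x ∧ T (galoisH1Bar ℓ B' σ y') = a • T y'} := by
  classical
  have hℓ : (ℓ : E) ≠ 0 := prime_natCast_ne_zero_numberField (E := E) ℓ
  -- a linear form `λ` with `λ x = 1`
  obtain ⟨lam, hlam⟩ : ∃ lam : (AlgebraicClosure ℚ_[ℓ] ⊗[ℚ_[ℓ]] Module.Dual ℚ_[ℓ] (B.rationalTateModule ℓ)) →ₗ[AlgebraicClosure ℚ_[ℓ]]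
      AlgebraicClosure ℚ_[ℓ], lam x = 1 := by
    obtain ⟨g, hg⟩ := LinearMap.exists_leftInverse_of_injective
      (LinearMap.toSpanSingleton (AlgebraicClosure ℚ_[ℓ]) _ x) (LinearMap.ker_toSpanSingleton (AlgebraicClosure ℚ_[ℓ]) hx)
    refine ⟨g, ?_⟩
    have h1 := LinearMap.congr_fun hg (1 : AlgebraicClosure ℚ_[ℓ])
    simpa only [LinearMap.coe_comp, Function.comp_apply, LinearMap.toSpanSingleton_apply, one_smul, LinearMap.id_coe,
      id_eq] using h1
  -- bases of the two rational Tate modules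
  haveI := Literature.AlgebraicGeometry.Motives.AbelianVariety.module_finite_rationalTateModule_of_cast_ne_zero B ℓ hℓ
  haveI := Literature.AlgebraicGeometry.Motives.AbelianVariety.module_finite_rationalTateModule_of_cast_ne_zero B' ℓ hℓ
  let b := Module.finBasis ℚ_[ℓ] (B.rationalTateModule ℓ)
  let b' := Module.finBasis ℚ_[ℓ] (B'.rationalTateModule ℓ)
  let bL := Algebra.TensorProduct.basis (AlgebraicClosure ℚ_[ℓ]) b.dualBasis
  let bL' := Algebra.TensorProduct.basis (AlgebraicClosure ℚ_[ℓ]) b'.dualBasis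
  -- the `ℚ_ℓ`-linear reconstruction maps of `x` and `y'`
  let n := Module.finrank ℚ_[ℓ] (B.rationalTateModule ℓ)
  let n' := Module.finrank ℚ_[ℓ] (B'.rationalTateModule ℓ)
  let X : (Fin n × Fin n → ℚ_[ℓ]) →ₗ[ℚ_[ℓ]] AlgebraicClosure ℚ_[ℓ] ⊗[ℚ_[ℓ]] Module.Dual ℚ_[ℓ] (B.rationalTateModule ℓ) :=
    ∑ k : Fin n × Fin n, (LinearMap.proj k : (Fin n × Fin n → ℚ_[ℓ]) →ₗ[ℚ_[ℓ]] ℚ_[ℓ]).smulRight (bL.repr x k.1 • bL k.2)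
  let X' : (Fin n' × Fin n' → ℚ_[ℓ]) →ₗ[ℚ_[ℓ]] AlgebraicClosure ℚ_[ℓ] ⊗[ℚ_[ℓ]] Module.Dual ℚ_[ℓ] (B'.rationalTateModule ℓ) :=
    ∑ k : Fin n' × Fin n', (LinearMap.proj k : (Fin n' × Fin n' → ℚ_[ℓ]) →ₗ[ℚ_[ℓ]] ℚ_[ℓ]).smulRight (bL'.repr y' k.1 • bL' k.2)
  -- the `ℚ_ℓ`-linear maps `u ↦ λ(u)·x`, `u ↦ λ(u)·T y'` and `T`
  let Lx : (AlgebraicClosure ℚ_[ℓ] ⊗[ℚ_[ℓ]] Module.Dual ℚ_[ℓ] (B.rationalTateModule ℓ)) →ₗ[ℚ_[ℓ]]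
      AlgebraicClosure ℚ_[ℓ] ⊗[ℚ_[ℓ]] Module.Dual ℚ_[ℓ] (B.rationalTateModule ℓ) := (lam.smulRight x).restrictScalars ℚ_[ℓ]
  let Ly : (AlgebraicClosure ℚ_[ℓ] ⊗[ℚ_[ℓ]] Module.Dual ℚ_[ℓ] (B.rationalTateModule ℓ)) →ₗ[ℚ_[ℓ]] W :=
    (lam.smulRight (T y')).restrictScalars ℚ_[ℓ]
  let TQ : (AlgebraicClosure ℚ_[ℓ] ⊗[ℚ_[ℓ]] Module.Dual ℚ_[ℓ] (B'.rationalTateModule ℓ)) →ₗ[ℚ_[ℓ]] W := T.restrictScalars ℚ_[ℓ]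
  obtain ⟨Φ, hΦdef⟩ : ∃ Φ : ((Fin n × Fin n → ℚ_[ℓ]) × (Fin n' × Fin n' → ℚ_[ℓ])) →ₗ[ℚ_[ℓ]]
      (AlgebraicClosure ℚ_[ℓ] ⊗[ℚ_[ℓ]] Module.Dual ℚ_[ℓ] (B.rationalTateModule ℓ)) × W,
      ∀ p, Φ p = (X p.1 - lam (X p.1) • x, T (X' p.2) - lam (X p.1) • T y') :=
    ⟨LinearMap.prod (X ∘ₗ LinearMap.fst _ _ _ - Lx ∘ₗ X ∘ₗ LinearMap.fst _ _ _)
      (TQ ∘ₗ X' ∘ₗ LinearMap.snd _ _ _ - Ly ∘ₗ X ∘ₗ LinearMap.fst _ _ _), fun p => rfl⟩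
  -- the continuous matrix-coefficient map
  let Ψ : Field.absoluteGaloisGroup E → (Fin n × Fin n → ℚ_[ℓ]) × (Fin n' × Fin n' → ℚ_[ℓ]) := fun σ =>
    (fun k => b.coord k.1 (B.rationalTateRep ℓ σ⁻¹ (b k.2)), fun k => b'.coord k.1 (B'.rationalTateRep ℓ σ⁻¹ (b' k.2)))
  have hΨ : Continuous Ψ := (continuous_coeffMap ℓ B b).prodMk (continuous_coeffMap ℓ B' b')
  -- the set is the preimage of `ker Φ`
  have hset : {σ : Field.absoluteGaloisGroup E | ∃ a : AlgebraicClosure ℚ_[ℓ],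
      galoisH1Bar ℓ B σ x = a • x ∧ T (galoisH1Bar ℓ B' σ y') = a • T y'} = Ψ ⁻¹' (LinearMap.ker Φ : Set _) := by
    ext σ
    have hX : X (Ψ σ).1 = galoisH1Bar ℓ B σ x := by
      rw [reconstruct_apply]; exact (galoisH1Bar_eq_reconstruct ℓ B b x σ).symm
    have hX' : X' (Ψ σ).2 = galoisH1Bar ℓ B' σ y' := by
      rw [reconstruct_apply]; exact (galoisH1Bar_eq_reconstruct ℓ B' b' y' σ).symm
    simp only [Set.mem_setOf_eq, Set.mem_preimage, SetLike.mem_coe, LinearMap.mem_ker]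
    rw [hΦdef, hX, hX', Prod.mk_eq_zero, sub_eq_zero, sub_eq_zero]
    constructor
    · rintro ⟨a, h1, h2⟩
      have ha : lam (galoisH1Bar ℓ B σ x) = a := by rw [h1, map_smul, hlam, smul_eq_mul, mul_one]
      rw [ha]
      exact ⟨h1, h2⟩
    · rintro ⟨h1, h2⟩
      exact ⟨_, h1, h2⟩
  rw [hset]
  exact (LinearMap.ker Φ).closed_of_finiteDimensional.preimage hΨ

end Closed

/-! ## §2. Every vector of `ℚ_ℓ^{ac} ⊗ H¹_ét(A_∞)` comes from one level; the Galois action there -/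
section Tower

open scoped Classical

variable {F E : Type} [Field F] [NumberField F] [IsTotallyReal F] [Field E] [NumberField E] [Algebra F E]
  [IsTotallyComplex E] [Algebra.IsQuadraticExtension F E]
variable {P5 : PropC5Data F E} {isotropicAt : ℕ → Prop} (C : Sec42Data P5 isotropicAt) (ℓ : ℕ) [Fact ℓ.Prime]

/-- Every vector of `ℚ_ℓ^{ac} ⊗_{ℚ_ℓ} H¹_ét(A_∞)` is the image of a vector of `ℚ_ℓ^{ac} ⊗ H¹_ét(A_K)` for ONE sufficiently small level `K`
(the colimit over the levels is directed, `RestOne.isDirectedOrder_idx`). [cite: Liu2021, §4.3 (FJcycle.tex l. 2158)] -/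
theorem exists_level_baseChange_of_eq (y : AlgebraicClosure ℚ_[ℓ] ⊗[ℚ_[ℓ]] C.etaleH1Tower ℓ) :
    ∃ (i : RestOne.Idx C) (y' : AlgebraicClosure ℚ_[ℓ] ⊗[ℚ_[ℓ]] C.etSysObj ℓ i),
      (Module.DirectLimit.of ℚ_[ℓ] (RestOne.Idx C) (C.etSysObj ℓ) (C.etSys ℓ) i).baseChange (AlgebraicClosure ℚ_[ℓ]) y' = y := by
  classical
  haveI := RestOne.nonempty_idx C
  haveI : IsDirected (RestOne.Idx C) (· ≤ ·) := RestOne.isDirectedOrder_idx C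
  induction y using TensorProduct.induction_on with
  | zero => exact ⟨Classical.arbitrary _, 0, map_zero _⟩
  | tmul c t =>
    obtain ⟨i, φ, hφ⟩ := Module.DirectLimit.exists_of t
    exact ⟨i, c ⊗ₜ φ, by rw [LinearMap.baseChange_tmul, hφ]⟩
  | add y₁ y₂ h₁ h₂ =>
    obtain ⟨i₁, y₁', h₁⟩ := h₁
    obtain ⟨i₂, y₂', h₂⟩ := h₂
    obtain ⟨k, hk₁, hk₂⟩ := exists_ge_ge i₁ i₂
    have hc₁ : Module.DirectLimit.of ℚ_[ℓ] (RestOne.Idx C) (C.etSysObj ℓ) (C.etSys ℓ) k ∘ₗ C.etSys ℓ i₁ k hk₁ =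
        Module.DirectLimit.of ℚ_[ℓ] (RestOne.Idx C) (C.etSysObj ℓ) (C.etSys ℓ) i₁ :=
      LinearMap.ext fun z => Module.DirectLimit.of_f
    have hc₂ : Module.DirectLimit.of ℚ_[ℓ] (RestOne.Idx C) (C.etSysObj ℓ) (C.etSys ℓ) k ∘ₗ C.etSys ℓ i₂ k hk₂ =
        Module.DirectLimit.of ℚ_[ℓ] (RestOne.Idx C) (C.etSysObj ℓ) (C.etSys ℓ) i₂ :=
      LinearMap.ext fun z => Module.DirectLimit.of_f
    have e₁ : (Module.DirectLimit.of ℚ_[ℓ] (RestOne.Idx C) (C.etSysObj ℓ) (C.etSys ℓ) k).baseChange (AlgebraicClosure ℚ_[ℓ])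
        ((C.etSys ℓ i₁ k hk₁).baseChange (AlgebraicClosure ℚ_[ℓ]) y₁') =
        (Module.DirectLimit.of ℚ_[ℓ] (RestOne.Idx C) (C.etSysObj ℓ) (C.etSys ℓ) i₁).baseChange (AlgebraicClosure ℚ_[ℓ]) y₁' := by
      rw [← LinearMap.comp_apply, ← LinearMap.baseChange_comp, hc₁]
    have e₂ : (Module.DirectLimit.of ℚ_[ℓ] (RestOne.Idx C) (C.etSysObj ℓ) (C.etSys ℓ) k).baseChange (AlgebraicClosure ℚ_[ℓ])
        ((C.etSys ℓ i₂ k hk₂).baseChange (AlgebraicClosure ℚ_[ℓ]) y₂') =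
        (Module.DirectLimit.of ℚ_[ℓ] (RestOne.Idx C) (C.etSysObj ℓ) (C.etSys ℓ) i₂).baseChange (AlgebraicClosure ℚ_[ℓ]) y₂' := by
      rw [← LinearMap.comp_apply, ← LinearMap.baseChange_comp, hc₂]
    refine ⟨k, (C.etSys ℓ i₁ k hk₁).baseChange (AlgebraicClosure ℚ_[ℓ]) y₁' +
      (C.etSys ℓ i₂ k hk₂).baseChange (AlgebraicClosure ℚ_[ℓ]) y₂', ?_⟩
    rw [map_add, e₁, e₂, h₁, h₂]

/-- The Galois action on `ℚ_ℓ^{ac} ⊗ H¹_ét(A_∞)` restricted to the image of the level `K` is the level's contragredient action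
`galoisH1Bar ℓ (A_K)` (naturality `towerRep_of`, base-changed). [cite: Liu2021, §4.3 (FJcycle.tex l. 2158–2160)] -/
theorem towerRep_baseChange_of_baseChange (i : RestOne.Idx C) (σ : Field.absoluteGaloisGroup E)
    (y' : AlgebraicClosure ℚ_[ℓ] ⊗[ℚ_[ℓ]] C.etSysObj ℓ i) :
    (C.towerRep ℓ σ).baseChange (AlgebraicClosure ℚ_[ℓ])
        ((Module.DirectLimit.of ℚ_[ℓ] (RestOne.Idx C) (C.etSysObj ℓ) (C.etSys ℓ) i).baseChange (AlgebraicClosure ℚ_[ℓ]) y') =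
      (Module.DirectLimit.of ℚ_[ℓ] (RestOne.Idx C) (C.etSysObj ℓ) (C.etSys ℓ) i).baseChange (AlgebraicClosure ℚ_[ℓ])
        (galoisH1Bar ℓ (C.A (OrderDual.ofDual i)) σ y') := by
  have h : C.towerRep ℓ σ ∘ₗ Module.DirectLimit.of ℚ_[ℓ] (RestOne.Idx C) (C.etSysObj ℓ) (C.etSys ℓ) i =
      Module.DirectLimit.of ℚ_[ℓ] (RestOne.Idx C) (C.etSysObj ℓ) (C.etSys ℓ) i ∘ₗ C.etaleH1Rep ℓ (OrderDual.ofDual i) σ :=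
    LinearMap.ext (C.towerRep_of ℓ i σ)
  have hb := congrArg (LinearMap.baseChange (AlgebraicClosure ℚ_[ℓ])) h
  rw [LinearMap.baseChange_comp, LinearMap.baseChange_comp] at hb
  exact LinearMap.congr_fun hb y'

/-- The base-changed Galois action on `ℚ_ℓ^{ac} ⊗ H¹_ét(A_∞)` is multiplicative in `σ`. [folklore] -/
private theorem towerRep_baseChange_mul_apply (σ τ : Field.absoluteGaloisGroup E) (y : AlgebraicClosure ℚ_[ℓ] ⊗[ℚ_[ℓ]] C.etaleH1Tower ℓ) :
    (C.towerRep ℓ (σ * τ)).baseChange (AlgebraicClosure ℚ_[ℓ]) y =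
      (C.towerRep ℓ σ).baseChange (AlgebraicClosure ℚ_[ℓ]) ((C.towerRep ℓ τ).baseChange (AlgebraicClosure ℚ_[ℓ]) y) := by
  rw [map_mul, Module.End.mul_eq_comp, LinearMap.baseChange_comp, LinearMap.comp_apply]

end Tower

/-! ## §3. [Thm 4.15] pinned from its Frobenius form -/
section Main

open scoped Classical

variable {F E : Type} [Field F] [NumberField F] [IsTotallyReal F] [Field E] [NumberField E] [Algebra F E]
  [IsTotallyComplex E] [Algebra.IsQuadraticExtension F E]
variable {P5 : PropC5Data F E} {isotropicAt : ℕ → Prop}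

-- ed. 3 (heartbeat, ops-buildfix B30): elaborates under 160 000 heartbeats (not under 120 000) at Lean's DEFAULT budget — the ed. 2
-- `maxHeartbeats 400000` line is deleted; statement and docstring byte-identical to ★ p631684 / p662811.
/-- **[Liu2021, Thm 4.15] PINNED ⇐ its FROBENIUS FORM («Frobenius-dense ⇒ all σ»).**  For the §4.2 datum `C`, carriers `U`, a Hecke
datum `X` on `H¹_ét(A_∞)`, `ι : ℂ ≃ ℚ_ℓ^{ac}`, a conjugate-symplectic `μ` and a pair `(A_μ, i_μ)` satisfying [Def 4.5 (2)] in FROBENIUS FORM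
(`Def45.IsCMCharacterMuAlg μ Aμ iμ`: «Frobenius at `v` acts on `T_ℓ A_μ` as `i_μ(μ^{alg}(ϖ_v))`»): IF, under the antecedents of Thm 4.15
(`3 ≤ n`, weight one, `ε` `μ`-admissible), for all places `v` outside a finite set every ARITHMETIC FROBENIUS at a prime above `v` acts on
`Hom_{ℚ_ℓ^{ac}[𝔾]}(ι∘ω(μ,ε,χ), ℚ_ℓ^{ac} ⊗ H¹_ét(A_∞))` by the scalar `ι(μ^{alg}(ϖ_v))⁻¹` — print's «`ρ_{τ',ℓ}(μ,ε,χ) ∘ τ' = μ^{alg}`» (l. 2180) read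
at Frobenii — THEN `Thm415Pinned C U ℓ X ι μ hμ Aμ iμ`: EVERY `σ ∈ Γ_E` acts on that Hom-space by the scalar it has on the `M_μ`-eigenline.
Proof: the common-eigenvector locus `Z` of (`x` on the line, `f w`) is closed (`isClosed_setOf_exists_common_smul`, `f w` pushed to one
level), multiplicative, and contains every arithmetic Frobenius over the cofinite set of places with an abelian-scheme model of `A_μ` (Serre–Tate good reduction, edition E-ST), unramified for `μ^{alg}`,
prime to `ℓ` and outside the given finite set (`galoisH1Bar_eq_smul_of_isCMCharacterMuAlg` + hypothesis); the tree's unconditional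
density criterion `absoluteGaloisGroup.eq_univ_of_frobenius_mem_of_hasDirichletDensity_one` gives `Z = Γ_E`.
[cite: Liu2021, Thm. 4.15 (FJcycle.tex l. 2177–2182) with §4.3 (l. 2162–2174) and Def. 4.5 (2) (l. 1952)]
[cite: SerreTate1968, §1] [cite: NeukirchANT1999, VII §13] -/
theorem thm415Pinned_of_frobenius (C : Sec42Data P5 isotropicAt) (U : UniformOmega C) (ℓ : ℕ) [Fact ℓ.Prime]
    (X : C.EtaleHeckeDatum ℓ) (ι : ℂ ≃+* AlgebraicClosure ℚ_[ℓ]) (μ : IdeleClassGroup E →ₜ* Circle)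
    (hμ : letI : IsCMField E := isCMField F E; IdeleClassGroup.IsConjugateSymplectic E μ)
    (Aμ : AbelianVariety E) (iμ : IdeleClassGroup.muAlgValueField E μ →+* Aμ.endAlgebra)
    (hA : Def45.IsCMCharacterMuAlg μ Aμ iμ)
    (hfrob : letI : IsCMField E := isCMField F E
      3 ≤ C.n → IdeleClassGroup.HasWeight E μ 1 →
        ∀ (ε : U.Eps), (∃ e : E, IsAdmissibleElement E hμ.cmType.1 e ∧ U.epsOf e = ε) → ∀ (χ : U.Chi),
          ∃ S : Set (HeightOneSpectrum (𝓞 E)), S.Finite ∧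
            ∀ v ∉ S, ∀ 𝔓 ∈ v.primesAbove, ∀ σ : Field.absoluteGaloisGroup E, IsArithFrobAt (𝓞 E) σ 𝔓 →
              ∀ f ∈ X.omegaHom ι (U.rho μ hμ ε χ), ∀ w : U.omega μ hμ ε χ,
                (C.towerRep ℓ σ).baseChange (AlgebraicClosure ℚ_[ℓ]) (f w) =
                  (ι ((IdeleClassGroup.muAlg E μ).valueAtUniformizer v))⁻¹ • f w) :
    Thm415Pinned C U ℓ X ι μ hμ Aμ iμ := by
  classical
  letI : IsCMField E := isCMField F E
  intro hn hw ε hε χ σ c hxc f hf w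
  obtain ⟨x, hx, hx0, hσx⟩ := hxc
  -- ed. 3 (heartbeat): `∃`-facts are bound by `have` before `obtain` destructures them (on an application `rcases`
  -- generalises the term over the goal; three sites, ≈ 60 k heartbeats) — proof otherwise unchanged, default budget.
  have hS0 := hfrob hn hw ε hε χ
  obtain ⟨S, hS, hS'⟩ := hS0
  -- push `f w` to one level of the tower
  have hlev := exists_level_baseChange_of_eq C ℓ (f w)
  obtain ⟨i, y', hy'⟩ := hlev
  -- the common-eigenvector locus
  set Z : Set (Field.absoluteGaloisGroup E) := {τ | ∃ a : AlgebraicClosure ℚ_[ℓ],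
    galoisH1Bar ℓ Aμ τ x = a • x ∧ (C.towerRep ℓ τ).baseChange (AlgebraicClosure ℚ_[ℓ]) (f w) = a • f w} with hZ
  -- (i) `Z` is closed
  have hZc : IsClosed Z := by
    have hZ' : Z = {τ | ∃ a : AlgebraicClosure ℚ_[ℓ], galoisH1Bar ℓ Aμ τ x = a • x ∧
        (Module.DirectLimit.of ℚ_[ℓ] (RestOne.Idx C) (C.etSysObj ℓ) (C.etSys ℓ) i).baseChange (AlgebraicClosure ℚ_[ℓ])
            (galoisH1Bar ℓ (C.A (OrderDual.ofDual i)) τ y') =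
          a • (Module.DirectLimit.of ℚ_[ℓ] (RestOne.Idx C) (C.etSysObj ℓ) (C.etSys ℓ) i).baseChange (AlgebraicClosure ℚ_[ℓ]) y'} := by
      have key : ∀ τ : Field.absoluteGaloisGroup E, (C.towerRep ℓ τ).baseChange (AlgebraicClosure ℚ_[ℓ]) (f w) =
          (Module.DirectLimit.of ℚ_[ℓ] (RestOne.Idx C) (C.etSysObj ℓ) (C.etSys ℓ) i).baseChange (AlgebraicClosure ℚ_[ℓ])
            (galoisH1Bar ℓ (C.A (OrderDual.ofDual i)) τ y') := by
        intro τ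
        rw [← hy']
        exact towerRep_baseChange_of_baseChange C ℓ i τ y'
      ext τ
      simp only [hZ, Set.mem_setOf_eq]
      constructor
      · rintro ⟨a, h1, h2⟩
        refine ⟨a, h1, ?_⟩
        rw [← key, h2, hy']
      · rintro ⟨a, h1, h2⟩
        refine ⟨a, h1, ?_⟩
        rw [key, h2, hy']
    rw [hZ']
    exact isClosed_setOf_exists_common_smul ℓ Aμ (C.A (OrderDual.ofDual i)) _ hx0 y'
  -- (ii) `Z` is stable under products, hence under positive powers
  have hmul : ∀ τ₁ ∈ Z, ∀ τ₂ ∈ Z, τ₁ * τ₂ ∈ Z := by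
    rintro τ₁ ⟨a₁, h₁, k₁⟩ τ₂ ⟨a₂, h₂, k₂⟩
    refine ⟨a₂ * a₁, ?_, ?_⟩
    · rw [galoisH1Bar_mul_apply, h₂, map_smul, h₁, smul_smul]
    · rw [towerRep_baseChange_mul_apply, k₂, map_smul, k₁, smul_smul]
  have hpow : ∀ τ ∈ Z, ∀ k : ℕ, 0 < k → τ ^ k ∈ Z := by
    intro τ hτ k hk
    induction k with
    | zero => exact absurd hk (lt_irrefl 0)
    | succ k ih =>
      rcases Nat.eq_zero_or_pos k with hk0 | hk0
      · subst hk0; simpa using hτ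
      · rw [pow_succ]; exact hmul _ (ih hk0) _ hτ
  -- (iii) `Z` contains every arithmetic Frobenius over a cofinite set of places
  have hSA0 := Literature.AlgebraicGeometry.Motives.AbelianVariety.exists_finite_forall_exists_isAbelianSchemeModel Aμ
  obtain ⟨SA, hSA, hgoodA⟩ := hSA0
  set Sbad : Set (HeightOneSpectrum (𝓞 E)) := S ∪ SA ∪
    {v | ¬ (IdeleClassGroup.muAlg E μ).IsUnramifiedAt v} ∪ {v | (ℓ : 𝓞 E) ∈ v.asIdeal} with hSbad
  have hur : {v : HeightOneSpectrum (𝓞 E) | ¬ (IdeleClassGroup.muAlg E μ).IsUnramifiedAt v}.Finite := by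
    have h : ∀ᶠ v : HeightOneSpectrum (𝓞 E) in Filter.cofinite, (IdeleClassGroup.muAlg E μ).IsUnramifiedAt v :=
      (IdeleClassGroup.muAlg E μ).finite_ramifiedPlaces_iff.1 (HeckeCharacter.finite_ramifiedPlaces_holds _)
    rwa [Filter.eventually_cofinite] at h
  have hfin : Sbad.Finite :=
    ((hS.union hSA).union hur).union (finite_setOf_prime_mem_asIdeal (E := E) ℓ)
  have hdens : HasDirichletDensity E Sbadᶜ 1 := hasDirichletDensity_one_of_cofinite (by rwa [compl_compl])
  have hfrobZ : ∀ v ∈ Sbadᶜ, ∀ 𝔓 ∈ v.primesAbove, ∀ Φ : Field.absoluteGaloisGroup E, IsArithFrobAt (𝓞 E) Φ 𝔓 → Φ ∈ Z := by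
    intro v hv 𝔓 h𝔓 Φ hΦ
    simp only [hSbad, Set.mem_compl_iff, Set.mem_union, Set.mem_setOf_eq, not_or, not_not] at hv
    obtain ⟨⟨⟨hvS, hvSA⟩, hunr⟩, hvℓ⟩ := hv
    exact ⟨_, galoisH1Bar_eq_smul_of_isCMCharacterMuAlg ℓ hA ι (hgoodA v hvSA) hunr hvℓ h𝔓 hΦ hx, hS' v hvS 𝔓 h𝔓 Φ hΦ f hf w⟩
  -- density criterion: `Z = Γ_E`
  have hZu : Z = Set.univ :=
    absoluteGaloisGroup.eq_univ_of_frobenius_mem_of_hasDirichletDensity_one hZc hpow hdens hfrobZ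
  have hσZ : σ ∈ Z := by rw [hZu]; exact Set.mem_univ σ
  obtain ⟨a, ha, ha'⟩ := hσZ
  have hac : a = c := smul_left_injective (AlgebraicClosure ℚ_[ℓ]) hx0 (ha.symm.trans hσx)
  rw [ha', hac]

end Main

end Literature.NumberTheory.Automorphic.Liu2021.AppendixC

end
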